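import Summits.QuantumFields.YangMills.Theorems.BalabanLadderInfVolRPLimit
import Summits.QuantumFields.YangMills.Theorems.InfiniteVolumeLatticeDistributions
import Summits.QuantumFields.YangMills.Theorems.BalabanLadderInfVolCeilingsDefs
import Summits.QuantumFields.GaugeBoot.ClassBLimitLinkRP
import HarnessLib

/-!
# Infinite-volume reflection positivity, V: E2 for the plane-string SERIES of thermodynamic-limit states

R136 (i) «infinite-volume ∕ continuum-from-UV» programme (director-ym), prover seat `ym-infvol-p3`, pre-birth
support filed `--supports` the spine leg `UV` (stmt-QuantumFields-19351) of `route-QuantumFields-BalabanLadder`.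
HONEST FRAMING: conditional material for the EXISTENCE half (OS0–OS3 of a continuum limit); not a mass gap, not
Clay; NOTHING is asserted about Yang–Mills beyond kernel-checked statements about torus limit states of the Wilson
lattice theory at `β ≥ 0`.

This file restates the exact lattice E2 of files I–IV in the currency the sibling seats landed for the route
(`ym-infvol-p1`: `InfiniteVolume.stateMomentStr`, Theorems/BalabanLadderInfVolCeilingsDefs.lean; `ym-infvol-p2`: the
plane-string SERIES `F ↦ Σ'_{x ∈ (ℤ⁴)ⁿ} W(x)·F(y x)` of a thermodynamic-limit state `μ ∈ oddTorusLimitPoints r β` and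
its subsequential continuum limits `S n q`, Theorems/InfiniteVolumeLatticeDistributions.lean
`exists_subseq_limit_oddTorusLimitPoints`), so that the route's E2 stub is an `exact`:

* §1 `integral_plane_eq_integral_plane_zero`, `stateMomentStr_eq_strWeight` — for a translation-invariant state
  (every torus limit point: tree `isZdTranslationInvariant_of_mem_infiniteVolumeLimitPoints`) p1's centred moment
  `stateMomentStr G r μ n q x` is the string weight `strWeight r μ q m₀ x` of file II with the site-free centrings
  `m₀ q = ∫ plane q 0 dμ`;
* §2 `tendsto_stateDist_atTop` — the box sums `stateDist r μ a B o m n F` of file III converge, as the box `B → ∞`,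
  to the series `Σ_{Q valid} Σ'_z W_μ(Q, z)·F(a (z + o∘Q))` (bounded weights × Schwartz decay: p2's
  `summable_mul_of_bounded`; boxes exhaust `(ℤ⁴)ⁿ`);
* §3 **`series_osForm_nonneg`** — EXACT E2 of the series functional of every site-RP probability measure on `ℤ⁴`
  gauge fields at every spacing `0 < a ≤ 1/4`, centre-type offsets of norm `≤ 1`, for every positive-time tuple with
  bounded time support (no box condition left); §4 **`stateMomentStr_series_osForm_nonneg`** — the same for
  `μ ∈ oddTorusLimitPoints r β`, `β ≥ 0`, written with p1's `stateMomentStr` (site-RP from GaugeBoot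
  `siteRP_zero_of_mem_infiniteVolumeLimitPoints`, translation invariance from the tree);
* §5 **`rpPos_of_stateMomentStr_series_tendsto`** (direct form: the orientation-summed series converge to `S₁` in
  every arity ⟹ `RPPos S₁`) and **`rpPos_of_oddTorusLimitStates_series`** ∕
  **`isReflectionPositive_of_oddTorusLimitStates_series`** — E2 OF THE CONTINUUM LIMIT in p2's currency: for `β k ≥ 0`, `μ k ∈ oddTorusLimitPoints r (β k)`, spacings `a k > 0`, `a k → 0`,
  centre-type offsets, continuum data `S n q` with `Σ'ₓ stateMomentStr(μ k) n q x · F(a k (x + o∘q)) → S n q F`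
  (`n ≥ 2`, valid `q`, `F ∈ ⁰𝒮ₙ`) and a one-field family `S₁` with `S₁ n = Σ_{q valid} S n q` (`n ≥ 2`),
  `S₁ 0 F = F()` and `S₁ 1 = 0`: `RPPos S₁` and `S₁.toLabelled.IsReflectionPositive`. With `o = centreOffset`
  (`rpPos_of_oddTorusLimitStates_centre`) every offset hypothesis is discharged.

References: K. Osterwalder, R. Schrader, CMP 31 (1973) §2, CMP 42 (1975) §4; K. Osterwalder, E. Seiler, Ann. Phys.
110 (1978) §2; J. Glimm, A. Jaffe, Quantum Physics (1987) §6.1.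
-/

noncomputable section

open scoped SchwartzMap BigOperators ComplexConjugate
open MeasureTheory Filter Topology
open Literature.MathematicalPhysics.QuantumFieldTheory Literature.MathematicalPhysics.QuantumLattice
open Literature.MathematicalPhysics.AQFT
open Literature.Probability.LatticeModels (box Site mem_box)
open Summit.QuantumFields.GaugeBoot (configSiteReflect siteHalfEdges IsReflectionPositiveFor
  siteRP_zero_of_mem_infiniteVolumeLimitPoints)
open Summit.QuantumFields.YangMills.Cruxes.OSLegsFromFemtoAndGap.DlrCollarTransfer
  (plane continuous_plane exists_abs_plane_le RPPos isReflectionPositive_of_rpPos)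
open Summit.QuantumFields.YangMills.Theorems.OSLegsFromFemtoAndGap (mem_planeStrings_iff'')
open Summit.QuantumFields.YangMills.Theorems.InfiniteVolume (stateMomentStr summable_mul_of_bounded)

namespace Summit.QuantumFields.YangMills.Theorems.InfVolRP

variable {G : Type} [Group G] [TopologicalSpace G] [IsTopologicalGroup G] [CompactSpace G]
  [MeasurableSpace G] [BorelSpace G]

/-! ### §1 Translation-invariant states: `stateMomentStr` is a string weight with site-free centrings -/

omit [IsTopologicalGroup G] [CompactSpace G] [BorelSpace G] in
/-- The plane field at `x` is the plane field at the origin read on the translated configuration. -/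
theorem plane_eq_plane_zero_configShift (r : LatticeRep G) (q : Fin 4 × Fin 4) (x : Site 4) (U : LGConfig 4 G) :
    plane G r q x U = plane G r q 0 (configShift (-x) U) := by
  unfold plane
  congr 1
  funext e
  simp only [configShift_apply, neg_zero, sub_zero]

omit [IsTopologicalGroup G] [CompactSpace G] [BorelSpace G] in
/-- **One-point functions of a translation-invariant state do not depend on the site.** -/
theorem integral_plane_eq_integral_plane_zero (r : LatticeRep G) {μ : Measure (LGConfig 4 G)}
    (hμ : IsZdTranslationInvariant μ) (q : Fin 4 × Fin 4) (x : Site 4) :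
    ∫ U, plane G r q x U ∂μ = ∫ U, plane G r q 0 U ∂μ := by
  simp_rw [plane_eq_plane_zero_configShift r q x]
  exact (MeasurePreserving.mk (configShift (-x)).measurable (hμ (-x))).integral_comp' (f := configShift (-x))
    (fun U => plane G r q 0 U)

omit [IsTopologicalGroup G] [CompactSpace G] [BorelSpace G] in
/-- **p1's centred plane-string moment is a string weight of file II** with the site-free centrings
`m₀ q = ∫ plane q 0 dμ`, for every translation-invariant state. -/
theorem stateMomentStr_eq_strWeight (r : LatticeRep G) {μ : Measure (LGConfig 4 G)} (hμ : IsZdTranslationInvariant μ)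
    {n : ℕ} (q : Fin n → Fin 4 × Fin 4) (x : Fin n → Site 4) :
    stateMomentStr G r μ n q x = strWeight r μ q (fun l => ∫ V, plane G r (q l) 0 V ∂μ) x := by
  unfold stateMomentStr strWeight strObs
  simp_rw [integral_plane_eq_integral_plane_zero r hμ]

/-! ### §2 Box sums converge to the series -/

/-- The summation boxes `(box 4 B)ⁿ` increase with `B`. -/
theorem piFinset_box_mono (n : ℕ) : Monotone fun B : ℕ => Fintype.piFinset fun _ : Fin n => box 4 B := by
  intro B B' h
  refine Fintype.piFinset_subset _ _ fun _ => ?_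
  intro x hx
  rw [mem_box] at hx ⊢
  intro i
  have := hx i
  constructor <;> omega

/-- The summation boxes `(box 4 B)ⁿ` exhaust `(ℤ⁴)ⁿ`. -/
theorem tendsto_piFinset_box_atTop (n : ℕ) :
    Tendsto (fun B : ℕ => Fintype.piFinset fun _ : Fin n => box 4 B) atTop atTop := by
  refine tendsto_atTop_finset_of_monotone (piFinset_box_mono n) fun z => ?_
  refine ⟨Finset.univ.sup fun li : Fin n × Fin 4 => (z li.1 li.2).natAbs, ?_⟩
  rw [Fintype.mem_piFinset]
  intro l
  rw [mem_box]
  intro i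
  have h : (z l i).natAbs ≤ Finset.univ.sup fun li : Fin n × Fin 4 => (z li.1 li.2).natAbs :=
    Finset.le_sup (f := fun li : Fin n × Fin 4 => (z li.1 li.2).natAbs) (Finset.mem_univ (l, i))
  constructor <;> omega

omit [BorelSpace G] in
/-- **Summability of the plane-string series of a probability measure** against a Schwartz function at offset
points `a (z + o∘Q)`, `0 < a ≤ 1`, `‖o q‖ ≤ 1`, `a ≤ 1/4` (bounded weights × Schwartz decay; p2's
`summable_mul_of_bounded`). -/
theorem summable_strWeight_mul (r : LatticeRep G) (μ : Measure (LGConfig 4 G)) [IsProbabilityMeasure μ]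
    {a : ℝ} (ha : 0 < a) (ha4 : a ≤ 1 / 4) {o : Fin 4 × Fin 4 → EuclideanSpace ℝ (Fin 4)} (hos : ∀ q, ‖o q‖ ≤ 1)
    (m : Fin 4 × Fin 4 → ℝ) {n : ℕ} (Q : Fin n → Fin 4 × Fin 4) (F : 𝓢((Fin n → EuclideanSpace ℝ (Fin 4)), ℂ)) :
    Summable fun z : Fin n → Site 4 =>
      ((strWeight r μ Q (fun l => m (Q l)) z : ℝ) : ℂ) * F (fun l => a • (siteToE (z l) + o (Q l))) := by
  obtain ⟨Cp, hCp⟩ := exists_abs_plane_le (G := G) r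
  have hCp0 : 0 ≤ Cp := (abs_nonneg _).trans (hCp (0, 0) 0 (fun _ => 1))
  set Cm : ℝ := ∑ q : Fin 4 × Fin 4, |m q|
  have hCm : ∀ q, |m q| ≤ Cm := fun q =>
    Finset.single_le_sum (f := fun q => |m q|) (fun _ _ => abs_nonneg _) (Finset.mem_univ q)
  have hCm0 : 0 ≤ Cm := Finset.sum_nonneg fun _ _ => abs_nonneg _
  refine summable_mul_of_bounded (s := 1) ha (by linarith) (by linarith) (pow_nonneg (add_nonneg hCp0 hCm0) n)
    (fun z => strWeight r μ Q (fun l => m (Q l)) z) (fun z => abs_strWeight_le r μ Q hCp (fun l => hCm (Q l)) z)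
    F (fun z l => a • (siteToE (z l) + o (Q l))) fun z l => ?_
  rw [smul_add, add_sub_cancel_left, norm_smul, Real.norm_eq_abs, abs_of_pos ha, mul_comm]
  exact mul_le_mul_of_nonneg_right (hos _) ha.le

omit [BorelSpace G] in
/-- **The box sums converge to the series**: `stateDist r μ a B o m n F → Σ_{Q valid} Σ'_z W_μ(Q, z)·F(a (z + o∘Q))`
as `B → ∞`. -/
theorem tendsto_stateDist_atTop (r : LatticeRep G) (μ : Measure (LGConfig 4 G)) [IsProbabilityMeasure μ]
    {a : ℝ} (ha : 0 < a) (ha4 : a ≤ 1 / 4) {o : Fin 4 × Fin 4 → EuclideanSpace ℝ (Fin 4)} (hos : ∀ q, ‖o q‖ ≤ 1)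
    (m : Fin 4 × Fin 4 → ℝ) (n : ℕ) (F : 𝓢((Fin n → EuclideanSpace ℝ (Fin 4)), ℂ)) :
    Tendsto (fun B => stateDist r μ a B o m n F) atTop
      (𝓝 (∑ Q ∈ Fintype.piFinset (fun _ : Fin n => Finset.univ.filter fun pl : Fin 4 × Fin 4 => pl.1 < pl.2),
        ∑' z : Fin n → Site 4,
          ((strWeight r μ Q (fun l => m (Q l)) z : ℝ) : ℂ) * F (fun l => a • (siteToE (z l) + o (Q l))))) := by
  unfold stateDist
  refine tendsto_finsetSum _ fun Q _ => ?_
  have h := ((summable_strWeight_mul r μ ha ha4 hos m Q F).hasSum).comp (tendsto_piFinset_box_atTop n)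
  refine h.congr fun B => ?_
  simp only [Function.comp_apply]
  exact Finset.sum_congr rfl fun z _ => mul_comm _ _

/-! ### §3 Exact E2 of the series functional of a site-RP state -/

/-- **Exact E2 of the plane-string SERIES of a site-RP probability measure.** For `0 < a ≤ 1/4`, centre-type offsets
of norm `≤ 1`, any centrings `m`, every positive-time tuple `Fⱼ` with time supports in `(0, T]` and witnesses `Hᵢⱼ`
of `ΘFᵢ* ⊗ Fⱼ`: the series OS form `z = Σᵢⱼ Σ_{Q valid} Σ'_w W_μ(Q, w)·Hᵢⱼ(a (w + o∘Q))` has `0 ≤ Re z`, `Im z = 0`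
(limit `B → ∞` of the exact box positivity `stateDist_osForm_nonneg`; no box condition remains). -/
theorem series_osForm_nonneg [SecondCountableTopology G] (r : LatticeRep G) {μ : Measure (LGConfig 4 G)}
    [IsProbabilityMeasure μ] (hμ : IsReflectionPositiveFor (configSiteReflect (G := G) 0) (siteHalfEdges 0) μ)
    {a : ℝ} (ha : 0 < a) (ha4 : a ≤ 1 / 4) {o : Fin 4 × Fin 4 → EuclideanSpace ℝ (Fin 4)} (hos : ∀ q, ‖o q‖ ≤ 1)
    (ho : ∀ q, 0 ≤ o q 0 ∧ o q 0 < 1) (hoc : ∀ q : Fin 4 × Fin 4, q.1 < q.2 → 2 * o q 0 = if q.1 = 0 then 1 else 0)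
    (m : Fin 4 × Fin 4 → ℝ) {T : ℝ} {N : ℕ} {deg : Fin N → ℕ}
    (F : (j : Fin N) → 𝓢((Fin (deg j) → EuclideanSpace ℝ (Fin 4)), ℂ))
    (hF : ∀ j (u : Fin (deg j) → EuclideanSpace ℝ (Fin 4)), (∃ l, u l 0 ≤ 0 ∨ T < u l 0) → F j u = 0)
    (H : (i j : Fin N) → 𝓢((Fin (deg i + deg j) → EuclideanSpace ℝ (Fin 4)), ℂ))
    (hH : ∀ i j, IsAppendTensorOf (H i j) (osAdjoint (F i)) (F j)) :
    let z := ∑ i, ∑ j,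
      ∑ Q ∈ Fintype.piFinset (fun _ : Fin (deg i + deg j) => Finset.univ.filter fun pl : Fin 4 × Fin 4 => pl.1 < pl.2),
        ∑' w : Fin (deg i + deg j) → Site 4,
          ((strWeight r μ Q (fun l => m (Q l)) w : ℝ) : ℂ) * H i j (fun l => a • (siteToE (w l) + o (Q l)))
    0 ≤ z.re ∧ z.im = 0 := by
  intro z
  have hconv : Tendsto (fun B => ∑ i, ∑ j, stateDist r μ a B o m (deg i + deg j) (H i j)) atTop (𝓝 z) :=
    tendsto_finsetSum _ fun i _ => tendsto_finsetSum _ fun j _ =>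
      tendsto_stateDist_atTop r μ ha ha4 hos m _ (H i j)
  -- eventually the box is large enough: `T + a ≤ a B`
  have hB : ∀ᶠ B : ℕ in atTop, T + a ≤ a * B := by
    have h := (tendsto_natCast_atTop_atTop (R := ℝ)).const_mul_atTop ha
    exact (h.eventually_ge_atTop (T + a)).mono fun B hB => hB
  have hev : ∀ᶠ B : ℕ in atTop, 0 ≤ (∑ i, ∑ j, stateDist r μ a B o m (deg i + deg j) (H i j)).re ∧
      (∑ i, ∑ j, stateDist r μ a B o m (deg i + deg j) (H i j)).im = 0 :=
    hB.mono fun B hTB => stateDist_osForm_nonneg r hμ ha hTB ho hoc m F hF H hH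
  exact ⟨ge_of_tendsto ((Complex.continuous_re.tendsto _).comp hconv) (hev.mono fun B h => h.1),
    tendsto_nhds_unique ((Complex.continuous_im.tendsto _).comp hconv)
      (tendsto_const_nhds.congr' (hev.mono fun B h => h.2.symm))⟩

/-! ### §4 The same for thermodynamic-limit states, in p1's currency -/

/-- Odd-torus thermodynamic-limit states are torus limit points (sides `2 S_k + 1`). -/
theorem mem_infiniteVolumeLimitPoints_of_mem_oddTorusLimitPoints (r : LatticeRep G) {β : ℝ}
    {μ : Measure (LGConfig 4 G)} (hμ : μ ∈ oddTorusLimitPoints r β) :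
    μ ∈ infiniteVolumeLimitPoints (d := 4) r.ρ β := by
  obtain ⟨S, hS, h⟩ := hμ
  exact ⟨fun k => 2 * S k, fun i j hij => by have := hS hij; dsimp only; omega, h⟩

/-- **Exact E2 of the plane-string series of a thermodynamic-limit state, p1's currency.** For `β ≥ 0`,
`μ ∈ oddTorusLimitPoints r β`, `0 < a ≤ 1/4`, centre-type offsets of norm `≤ 1`, a positive-time tuple with time
supports in `(0, T]` and witnesses `Hᵢⱼ`: `z = Σᵢⱼ Σ_{Q valid} Σ'_w stateMomentStr G r μ _ Q w · Hᵢⱼ(a (w + o∘Q))` has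
`0 ≤ Re z` and `Im z = 0`. -/
theorem stateMomentStr_series_osForm_nonneg [T2Space G] [SecondCountableTopology G] (r : LatticeRep G) {β : ℝ}
    (hβ : 0 ≤ β) {μ : Measure (LGConfig 4 G)} (hμ : μ ∈ oddTorusLimitPoints r β)
    {a : ℝ} (ha : 0 < a) (ha4 : a ≤ 1 / 4) {o : Fin 4 × Fin 4 → EuclideanSpace ℝ (Fin 4)} (hos : ∀ q, ‖o q‖ ≤ 1)
    (ho : ∀ q, 0 ≤ o q 0 ∧ o q 0 < 1) (hoc : ∀ q : Fin 4 × Fin 4, q.1 < q.2 → 2 * o q 0 = if q.1 = 0 then 1 else 0)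
    {T : ℝ} {N : ℕ} {deg : Fin N → ℕ} (F : (j : Fin N) → 𝓢((Fin (deg j) → EuclideanSpace ℝ (Fin 4)), ℂ))
    (hF : ∀ j (u : Fin (deg j) → EuclideanSpace ℝ (Fin 4)), (∃ l, u l 0 ≤ 0 ∨ T < u l 0) → F j u = 0)
    (H : (i j : Fin N) → 𝓢((Fin (deg i + deg j) → EuclideanSpace ℝ (Fin 4)), ℂ))
    (hH : ∀ i j, IsAppendTensorOf (H i j) (osAdjoint (F i)) (F j)) :
    let z := ∑ i, ∑ j,
      ∑ Q ∈ Fintype.piFinset (fun _ : Fin (deg i + deg j) => Finset.univ.filter fun pl : Fin 4 × Fin 4 => pl.1 < pl.2),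
        ∑' w : Fin (deg i + deg j) → Site 4,
          ((stateMomentStr G r μ (deg i + deg j) Q w : ℝ) : ℂ) * H i j (fun l => a • (siteToE (w l) + o (Q l)))
    0 ≤ z.re ∧ z.im = 0 := by
  have hμ' := mem_infiniteVolumeLimitPoints_of_mem_oddTorusLimitPoints r hμ
  obtain ⟨L, -, hprob, -⟩ := id hμ'
  have hTI : IsZdTranslationInvariant μ := isZdTranslationInvariant_of_mem_infiniteVolumeLimitPoints r.ρ hμ'
  simp_rw [stateMomentStr_eq_strWeight r hTI]
  exact series_osForm_nonneg r (siteRP_zero_of_mem_infiniteVolumeLimitPoints r.ρ r.continuous hβ hμ') ha ha4 hos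
    ho hoc (fun q => ∫ V, plane G r q 0 V ∂μ) F hF H hH

/-! ### §5 E2 of the continuum limit, p2's currency -/

/-- Plane fields are integrable against a finite measure. -/
theorem integrable_plane [SecondCountableTopology G] (r : LatticeRep G) (μ : Measure (LGConfig 4 G))
    [IsFiniteMeasure μ] (q : Fin 4 × Fin 4) (x : Site 4) : Integrable (plane G r q x) μ := by
  obtain ⟨Cp, hCp⟩ := exists_abs_plane_le (G := G) r
  exact Integrable.of_bound (continuous_plane r q x).measurable.aestronglyMeasurable Cp
    (Eventually.of_forall fun U => by rw [Real.norm_eq_abs]; exact hCp q x U)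

/-- The centred one-point weight vanishes: `stateMomentStr G r μ 1 q x = 0` for a probability measure. -/
theorem stateMomentStr_one [SecondCountableTopology G] (r : LatticeRep G) (μ : Measure (LGConfig 4 G))
    [IsProbabilityMeasure μ] (q : Fin 1 → Fin 4 × Fin 4) (x : Fin 1 → Site 4) : stateMomentStr G r μ 1 q x = 0 := by
  unfold stateMomentStr
  simp only [Fin.prod_univ_one]
  rw [integral_sub (integrable_plane r μ _ _) (integrable_const _), integral_const, smul_eq_mul]
  simp

omit [IsTopologicalGroup G] [CompactSpace G] [BorelSpace G] in
/-- The empty-string weight is one: `stateMomentStr G r μ 0 q x = 1` for a probability measure. -/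
theorem stateMomentStr_zero (r : LatticeRep G) (μ : Measure (LGConfig 4 G)) [IsProbabilityMeasure μ]
    (q : Fin 0 → Fin 4 × Fin 4) (x : Fin 0 → Site 4) : stateMomentStr G r μ 0 q x = 1 := by
  unfold stateMomentStr
  simp

/-- **E2 of the continuum limit of thermodynamic-limit states, direct form.** Let `β k ≥ 0` eventually,
`μ k ∈ oddTorusLimitPoints r (β k)`, spacings `a k > 0` with `a k → 0`, centre-type offsets `o` of norm `≤ 1`. If the
orientation-summed series functionals `F ↦ Σ_{Q valid} Σ'ₓ stateMomentStr G r (μ k) n Q x · F(a k (x + o∘Q))` converge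
for every off-diagonal `F` (all arities) to a one-field family `S₁`, then `RPPos S₁`. -/
theorem rpPos_of_stateMomentStr_series_tendsto [T2Space G] [SecondCountableTopology G] (r : LatticeRep G)
    {β : ℕ → ℝ} (hβ : ∀ᶠ k in atTop, 0 ≤ β k) (μ : ℕ → Measure (LGConfig 4 G))
    (hμ : ∀ k, μ k ∈ oddTorusLimitPoints r (β k)) {a : ℕ → ℝ} (ha : ∀ k, 0 < a k) (ha0 : Tendsto a atTop (𝓝 0))
    {o : Fin 4 × Fin 4 → EuclideanSpace ℝ (Fin 4)} (hos : ∀ q, ‖o q‖ ≤ 1) (ho : ∀ q, 0 ≤ o q 0 ∧ o q 0 < 1)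
    (hoc : ∀ q : Fin 4 × Fin 4, q.1 < q.2 → 2 * o q 0 = if q.1 = 0 then 1 else 0)
    (S₁ : SchwingerFamily (EuclideanSpace ℝ (Fin 4)))
    (hlim : ∀ (n : ℕ) (F : 𝓢((Fin n → EuclideanSpace ℝ (Fin 4)), ℂ)), IsOffDiagonal F →
      Tendsto (fun k =>
        ∑ Q ∈ Fintype.piFinset (fun _ : Fin n => Finset.univ.filter fun pl : Fin 4 × Fin 4 => pl.1 < pl.2),
          ∑' x : Fin n → Site 4,
            ((stateMomentStr G r (μ k) n Q x : ℝ) : ℂ) * F (fun l => a k • (siteToE (x l) + o (Q l)))) atTop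
        (𝓝 (S₁ n F))) :
    RPPos S₁ := by
  refine rpPos_of_eventually_nonneg S₁ _ hlim fun T N deg F _ _ hFT => ?_
  have h4 : ∀ᶠ k in atTop, a k ≤ 1 / 4 :=
    ((tendsto_order.1 ha0).2 (1 / 4) (by norm_num)).mono fun k hk => hk.le
  filter_upwards [h4, hβ] with k hk hβk
  exact stateMomentStr_series_osForm_nonneg r hβk (hμ k) (ha k) hk hos ho hoc F hFT
    (fun i j => (osAdjoint (F i)).appendTensor (F j)) (fun i j => isAppendTensorOf_appendTensor _ _)

/-- **E2 of the continuum limit of thermodynamic-limit states (p2's currency).** Let `β k ≥ 0` eventually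
(e.g. `β k → ∞`),
`μ k ∈ oddTorusLimitPoints r (β k)`, spacings `a k > 0` with `a k → 0`, centre-type offsets `o` of norm `≤ 1`, and
continuum data `S n q` with `Σ'ₓ stateMomentStr G r (μ k) n q x · F(a k (x + o∘q)) → S n q F` for `n ≥ 2`, valid `q`,
`F ∈ ⁰𝒮ₙ` (the output of p2's `exists_subseq_limit_oddTorusLimitPoints` along the extracted subsequence). Then every
one-field family `S₁` with `S₁ n = Σ_{q valid} S n q` for `n ≥ 2`, `S₁ 0 F = F()` and `S₁ 1 = 0` is reflection
positive on all positive-time off-diagonal tuples (`RPPos`). -/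
theorem rpPos_of_oddTorusLimitStates_series [T2Space G] [SecondCountableTopology G] (r : LatticeRep G)
    {β : ℕ → ℝ} (hβ : ∀ᶠ k in atTop, 0 ≤ β k) (μ : ℕ → Measure (LGConfig 4 G))
    (hμ : ∀ k, μ k ∈ oddTorusLimitPoints r (β k)) {a : ℕ → ℝ} (ha : ∀ k, 0 < a k) (ha0 : Tendsto a atTop (𝓝 0))
    {o : Fin 4 × Fin 4 → EuclideanSpace ℝ (Fin 4)} (hos : ∀ q, ‖o q‖ ≤ 1) (ho : ∀ q, 0 ≤ o q 0 ∧ o q 0 < 1)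
    (hoc : ∀ q : Fin 4 × Fin 4, q.1 < q.2 → 2 * o q 0 = if q.1 = 0 then 1 else 0)
    (S : (n : ℕ) → (Fin n → Fin 4 × Fin 4) → (𝓢((Fin n → EuclideanSpace ℝ (Fin 4)), ℂ) →L[ℂ] ℂ))
    (hS : ∀ n : ℕ, 2 ≤ n → ∀ q : Fin n → Fin 4 × Fin 4, (∀ i, (q i).1 < (q i).2) →
      ∀ F : 𝓢((Fin n → EuclideanSpace ℝ (Fin 4)), ℂ), IsOffDiagonal F →
        Tendsto (fun k => ∑' x : Fin n → Site 4,
          ((stateMomentStr G r (μ k) n q x : ℝ) : ℂ) * F (fun l => a k • (siteToE (x l) + o (q l)))) atTop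
          (𝓝 (S n q F)))
    (S₁ : SchwingerFamily (EuclideanSpace ℝ (Fin 4)))
    (hS₁ : ∀ n : ℕ, 2 ≤ n → ∀ F : 𝓢((Fin n → EuclideanSpace ℝ (Fin 4)), ℂ),
      S₁ n F = ∑ q ∈ Fintype.piFinset (fun _ : Fin n => Finset.univ.filter fun pl : Fin 4 × Fin 4 => pl.1 < pl.2),
        S n q F)
    (hS₁0 : ∀ F : 𝓢((Fin 0 → EuclideanSpace ℝ (Fin 4)), ℂ), S₁ 0 F = F default)
    (hS₁1 : ∀ F : 𝓢((Fin 1 → EuclideanSpace ℝ (Fin 4)), ℂ), S₁ 1 F = 0) :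
    RPPos S₁ := by
  classical
  haveI hprob : ∀ k, IsProbabilityMeasure (μ k) := fun k => by
    obtain ⟨L, -, hprob, -⟩ := mem_infiniteVolumeLimitPoints_of_mem_oddTorusLimitPoints r (hμ k)
    exact hprob
  refine rpPos_of_stateMomentStr_series_tendsto r hβ μ hμ ha ha0 hos ho hoc S₁ fun n F hF => ?_
  -- convergence in every arity
  rcases Nat.lt_or_ge n 2 with hn | hn
  · interval_cases n
    · -- arity 0: the empty string, weight 1, one point
      have hval : ∀ k, (∑ Q ∈ Fintype.piFinset (fun _ : Fin 0 => Finset.univ.filter fun pl : Fin 4 × Fin 4 => pl.1 < pl.2),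
          ∑' x : Fin 0 → Site 4, ((stateMomentStr G r (μ k) 0 Q x : ℝ) : ℂ) *
            F (fun l => a k • (siteToE (x l) + o (Q l)))) = S₁ 0 F := by
        intro k
        rw [hS₁0]
        have hpt : ∀ (Q : Fin 0 → Fin 4 × Fin 4) (x : Fin 0 → Site 4),
            F (fun l => a k • (siteToE (x l) + o (Q l))) = F default := fun Q x =>
          congrArg F (Subsingleton.elim _ _)
        simp_rw [stateMomentStr_zero, hpt, Complex.ofReal_one, one_mul]
        rw [tsum_const, Nat.card_unique, one_smul, Finset.sum_const, Finset.card_eq_one.2 ⟨default, ?_⟩, one_smul]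
        ext Q
        simp only [Fintype.mem_piFinset, Finset.mem_singleton, IsEmpty.forall_iff, true_iff]
        exact Subsingleton.elim _ _
      simp_rw [hval]
      exact tendsto_const_nhds
    · -- arity 1: the centred one-point weights vanish
      simp_rw [stateMomentStr_one, Complex.ofReal_zero, zero_mul, tsum_zero, Finset.sum_const_zero, hS₁1]
      exact tendsto_const_nhds
  · rw [hS₁ n hn F]
    exact tendsto_finsetSum _ fun Q hQ => hS n hn Q ((mem_planeStrings_iff'' Q).1 hQ) F hF

/-- **E2 (`IsReflectionPositive`) of the continuum limit of thermodynamic-limit states, p2's currency.** -/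
theorem isReflectionPositive_of_oddTorusLimitStates_series [T2Space G] [SecondCountableTopology G]
    (r : LatticeRep G) {β : ℕ → ℝ} (hβ : ∀ᶠ k in atTop, 0 ≤ β k) (μ : ℕ → Measure (LGConfig 4 G))
    (hμ : ∀ k, μ k ∈ oddTorusLimitPoints r (β k)) {a : ℕ → ℝ} (ha : ∀ k, 0 < a k) (ha0 : Tendsto a atTop (𝓝 0))
    {o : Fin 4 × Fin 4 → EuclideanSpace ℝ (Fin 4)} (hos : ∀ q, ‖o q‖ ≤ 1) (ho : ∀ q, 0 ≤ o q 0 ∧ o q 0 < 1)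
    (hoc : ∀ q : Fin 4 × Fin 4, q.1 < q.2 → 2 * o q 0 = if q.1 = 0 then 1 else 0)
    (S : (n : ℕ) → (Fin n → Fin 4 × Fin 4) → (𝓢((Fin n → EuclideanSpace ℝ (Fin 4)), ℂ) →L[ℂ] ℂ))
    (hS : ∀ n : ℕ, 2 ≤ n → ∀ q : Fin n → Fin 4 × Fin 4, (∀ i, (q i).1 < (q i).2) →
      ∀ F : 𝓢((Fin n → EuclideanSpace ℝ (Fin 4)), ℂ), IsOffDiagonal F →
        Tendsto (fun k => ∑' x : Fin n → Site 4,
          ((stateMomentStr G r (μ k) n q x : ℝ) : ℂ) * F (fun l => a k • (siteToE (x l) + o (q l)))) atTop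
          (𝓝 (S n q F)))
    (S₁ : SchwingerFamily (EuclideanSpace ℝ (Fin 4)))
    (hS₁ : ∀ n : ℕ, 2 ≤ n → ∀ F : 𝓢((Fin n → EuclideanSpace ℝ (Fin 4)), ℂ),
      S₁ n F = ∑ q ∈ Fintype.piFinset (fun _ : Fin n => Finset.univ.filter fun pl : Fin 4 × Fin 4 => pl.1 < pl.2),
        S n q F)
    (hS₁0 : ∀ F : 𝓢((Fin 0 → EuclideanSpace ℝ (Fin 4)), ℂ), S₁ 0 F = F default)
    (hS₁1 : ∀ F : 𝓢((Fin 1 → EuclideanSpace ℝ (Fin 4)), ℂ), S₁ 1 F = 0) :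
    S₁.toLabelled.IsReflectionPositive :=
  isReflectionPositive_of_rpPos (rpPos_of_oddTorusLimitStates_series r hβ μ hμ ha ha0 hos ho hoc S hS S₁ hS₁ hS₁0 hS₁1)

/-! ### Plaquette-centre offsets discharge every offset hypothesis -/

/-- The plaquette-centre offsets have norm `≤ 1`. -/
theorem norm_centreOffset_le_one (q : Fin 4 × Fin 4) : ‖centreOffset q‖ ≤ 1 := by
  unfold centreOffset
  split_ifs
  · rw [norm_smul, Real.norm_eq_abs, abs_of_pos (by norm_num : (0 : ℝ) < 1 / 2)]
    have h := norm_add_le (EuclideanSpace.single q.1 (1 : ℝ)) (EuclideanSpace.single q.2 (1 : ℝ))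
    have h1 : ‖(EuclideanSpace.single q.1 (1 : ℝ) : EuclideanSpace ℝ (Fin 4))‖ = 1 := by
      rw [PiLp.norm_single, norm_one]
    have h2 : ‖(EuclideanSpace.single q.2 (1 : ℝ) : EuclideanSpace ℝ (Fin 4))‖ = 1 := by
      rw [PiLp.norm_single, norm_one]
    rw [h1, h2] at h
    linarith
  · rw [norm_zero]; exact zero_le_one

/-- **E2 of the continuum limit of thermodynamic-limit states, plaquette-CENTRE smearing** (`o = centreOffset`):
every offset hypothesis of `rpPos_of_oddTorusLimitStates_series` is discharged. -/
theorem rpPos_of_oddTorusLimitStates_centre [T2Space G] [SecondCountableTopology G] (r : LatticeRep G)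
    {β : ℕ → ℝ} (hβ : ∀ᶠ k in atTop, 0 ≤ β k) (μ : ℕ → Measure (LGConfig 4 G))
    (hμ : ∀ k, μ k ∈ oddTorusLimitPoints r (β k)) {a : ℕ → ℝ} (ha : ∀ k, 0 < a k) (ha0 : Tendsto a atTop (𝓝 0))
    (S : (n : ℕ) → (Fin n → Fin 4 × Fin 4) → (𝓢((Fin n → EuclideanSpace ℝ (Fin 4)), ℂ) →L[ℂ] ℂ))
    (hS : ∀ n : ℕ, 2 ≤ n → ∀ q : Fin n → Fin 4 × Fin 4, (∀ i, (q i).1 < (q i).2) →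
      ∀ F : 𝓢((Fin n → EuclideanSpace ℝ (Fin 4)), ℂ), IsOffDiagonal F →
        Tendsto (fun k => ∑' x : Fin n → Site 4,
          ((stateMomentStr G r (μ k) n q x : ℝ) : ℂ) * F (fun l => a k • (siteToE (x l) + centreOffset (q l))))
          atTop (𝓝 (S n q F)))
    (S₁ : SchwingerFamily (EuclideanSpace ℝ (Fin 4)))
    (hS₁ : ∀ n : ℕ, 2 ≤ n → ∀ F : 𝓢((Fin n → EuclideanSpace ℝ (Fin 4)), ℂ),
      S₁ n F = ∑ q ∈ Fintype.piFinset (fun _ : Fin n => Finset.univ.filter fun pl : Fin 4 × Fin 4 => pl.1 < pl.2),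
        S n q F)
    (hS₁0 : ∀ F : 𝓢((Fin 0 → EuclideanSpace ℝ (Fin 4)), ℂ), S₁ 0 F = F default)
    (hS₁1 : ∀ F : 𝓢((Fin 1 → EuclideanSpace ℝ (Fin 4)), ℂ), S₁ 1 F = 0) :
    RPPos S₁ ∧ S₁.toLabelled.IsReflectionPositive :=
  have h := rpPos_of_oddTorusLimitStates_series r hβ μ hμ ha ha0 norm_centreOffset_le_one centreOffset_time
    (fun _ hq => two_mul_centreOffset_zero hq) S hS S₁ hS₁ hS₁0 hS₁1
  ⟨h, isReflectionPositive_of_rpPos h⟩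

end Summit.QuantumFields.YangMills.Theorems.InfVolRP

end
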